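import Summits.BirchSwinnertonDyer.BirchSwinnertonDyer.Theorems.GenusKolyvaginAtTwoGenusDeepSupplyAtTwoNegDiscNarrowKFourCellHalvingDescentKFourNeg
import Summits.BirchSwinnertonDyer.BirchSwinnertonDyer.Theorems.GenusKolyvaginAtTwoGenusPrimitiveSupplyAtTwoPosDiscShallowKFourPosHalvingDescentCorollaries
import HarnessLib

/-!
# KIT (LEAD gk2-p1 g24, for the route pen — NOT a Theorems proposal): the DEPTH-ONE ITEM TEXTS for crux 23491 / K4Neg (31526)
# and crux 25504 / K4Pos (31469), on the multiplicative cut, with Q2 as antecedent — and their BY-NAME closers (rc 0)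

Director (546)/(549)(B): ONE additive depth-one item (count-neutral until closed).  Statement of record (LEAD g23 11:28Z, confirmed g24): the
ℚ-side road B2Q♭ (gk2-p5 g36) covers the WHOLE depth-one sub-cell of K4Neg ON THE CUT modulo Q2 — file p771204
`…GenusDeepSupplyAtTwoNegDiscNarrowKFourCellHalvingDescentKFourNeg`, theorem
`GenusExact.PlusDescent.kFourNeg_conclusion_of_depth_one_of_hasMultiplicativeReductionAt`.  NOT covered (and not claimed): depth-one cells with NO
odd multiplicative prime (NPh_K undischarged; they lie in `OffCutResidualAtTwoR`'s first slice anyway).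

`K4NegDepthOneOnCut` below = `KolyvaginRelationAtTwo →` K4Neg's binders VERBATIM (same order) with the cut `∀ v, 2 ∉ v → N_E ∈ v → mult v →`
inserted right after `#Sel₂(E) = 4 →` and `M₀ = 1 →` in place of `1 ≤ M₀ →`; conclusion = K4Neg's conclusion VERBATIM.  The closer is the eta-expansion
of gk2-p5's theorem.  If the pen prefers Q2 NOT as an antecedent, drop `KolyvaginRelationAtTwo →` — the item then closes only modulo 24880 (conditional).
`K4PosDepthOneOnCut` = the same for K4Pos (31469): `KolyvaginRelationAtTwo →` K4Pos's binders VERBATIM, the cut inserted right after the real-narrow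
Selmer clause, `M₀ = 1 →` in place of `1 ≤ M₀ →`; closer = eta of gk2-p5's `kFourPos_conclusion_of_depth_one_of_hasMultiplicativeReductionAt` (p771276).
BSD is NOT proved by any of this; K4Neg (31526) / K4Pos (31469) at depth ≥ 2 stay OPEN.
-/

set_option autoImplicit false
set_option linter.dupNamespace false

noncomputable section

namespace Summit.BirchSwinnertonDyer.BirchSwinnertonDyer.Theorems.GenusSupplyNarrow.KFourCell.DepthOneItem

open Summit.BirchSwinnertonDyer.BirchSwinnertonDyer.Theses.GenusKolyvaginAtTwo (KolyvaginRelationAtTwo)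

/-- PROPOSED ITEM TEXT «K4NegDepthOneOnCut» (support/crux child of 23491, additive): K4Neg on its depth-one sub-cell (`M₀ = 1`), on the
multiplicative cut, Q2 as antecedent.  Binders = K4Neg VERBATIM + cut + `M₀ = 1`. -/
def K4NegDepthOneOnCut : Prop :=
  KolyvaginRelationAtTwo → ∀ (W : WeierstrassCurve ℚ) [W.IsElliptic] [W.IsGloballyMinimal] [NeZero (W.conductorNorm ℤ)], ¬ W.HasCM → W.analyticRank = 0 → (∀ n : ℕ, 0 < n → W.HasSurjectiveModNGaloisRep ((2 : ℤ) ^ n)) → Odd W.tamagawaProduct → W.Δ < 0 → Nat.card (W.selmerGroup 2) = 4 → ∀ (v : IsDedekindDomain.HeightOneSpectrum (NumberField.RingOfIntegers ℚ)), ((2 : ℕ) : NumberField.RingOfIntegers ℚ) ∉ v.asIdeal → ((W.conductorNorm ℤ : ℕ) : NumberField.RingOfIntegers ℚ) ∈ v.asIdeal → W.HasMultiplicativeReductionAt v → ∀ (K : Type) [Field K] [NumberField K], Literature.NumberTheory.EllipticCurves.IsImaginaryQuadratic K → Odd (NumberField.discr K) → NumberField.discr K ≠ -3 → Literature.NumberTheory.EllipticCurves.SatisfiesHeegnerHypothesis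 (W.conductorNorm ℤ) K → ¬ IsSquare ((NumberField.discr K : ℚ) * -|W.Δ|) → ¬ IsSquare ((NumberField.discr K : ℚ) * (-(2 * |W.Δ|))) → ∀ (ℓ₀ : ℕ), ℓ₀.Prime → NumberField.discr K = -(ℓ₀ : ℤ) → ((Ideal.span {(2 : ℤ)}).primesOver (NumberField.RingOfIntegers K)).ncard = 2 → ∀ (Dt : Literature.NumberTheory.EllipticCurves.ModularForms.ModularParametrizationData W (W.conductorNorm ℤ)), (∀ z ∈ Dt.L.lattice, ∃ w ∈ Literature.NumberTheory.EllipticCurves.ModularForms.periodLattice Dt.f, z = (Dt.c : ℂ) * w) → Odd Dt.c → ∀ (β : ℤ) (ι : K →+* ℂ) (d₁ : Literature.NumberTheory.EllipticCurves.KolyvaginHeegnerData Dt β ι 1), ¬ IsOfFinAddOrder d₁.derivedPoint → ∀ (M₀ : ℕ), (∃ Q : (W.baseChange (Literature.NumberTheory.EllipticCurves.ringClassField K ι 1)).toAffine.Point, ((2 ^ M₀ : ℕ) : ℤ) • Q = d₁.derivedPoint) → (¬ ∃ Q : (W.baseChange (Literature.NumberTheory.EllipticCurves.ringClassField K ι 1)).toAffine.Point,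 ((2 ^ (M₀ + 1) : ℕ) : ℤ) • Q = d₁.derivedPoint) → M₀ = 1 → ∀ (Wd : WeierstrassCurve ℚ) [Wd.IsElliptic] [Wd.IsGloballyMinimal], (∃ C : WeierstrassCurve.VariableChange ℚ, C • W.quadraticTwist (NumberField.discr K : ℚ) = Wd) → Wd.analyticRank = 1 → Nat.card (Wd.selmerGroup 2) = 2 → padicValNat 2 Wd.tamagawaProduct ≤ 1 → ∃ (n : ℕ) (d : Literature.NumberTheory.EllipticCurves.KolyvaginHeegnerData Dt β ι n), Squarefree n ∧ (∀ ℓ ∈ n.primeFactors, Literature.NumberTheory.EllipticCurves.Zhang2014.IsKolyvaginPrime (W.conductorNorm ℤ) W K 2 ℓ ∧ 2 ≤ Literature.NumberTheory.EllipticCurves.Zhang2014.kolyvaginIndex W 2 ℓ ∧ Literature.NumberTheory.EllipticCurves.FrobEqFrobInfty W K 2 ℓ) ∧ ¬ ∃ Q : (W.baseChange (Literature.NumberTheory.EllipticCurves.ringClassField K ι n)).toAffine.Point, (2 : ℤ) • Q = d.derivedPoint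

/-- The BY-NAME closer of the proposed item (eta-expansion of gk2-p5 g36's `kFourNeg_conclusion_of_depth_one_of_hasMultiplicativeReductionAt`,
p771204).  BSD is NOT proved by this; K4Neg at depth ≥ 2 stays open. -/
theorem k4NegDepthOneOnCut_holds : K4NegDepthOneOnCut :=
  fun hQ2 W _ _ _ hcm hr0 hρ hT hneg h4 v h2v hNv hmult K _ _ hIQ hodd h3 hHe hsq1 hsq2 ℓ₀ hℓ₀ hdK h2K Dt hopt hc β ι d₁ hy M₀ hdiv hndiv hM₀
      Wd _ _ hWd hrd hSel hTam ↦
    GenusExact.PlusDescent.kFourNeg_conclusion_of_depth_one_of_hasMultiplicativeReductionAt hQ2 W hcm hr0 hρ hT hneg h4 v h2v hNv hmult K hIQ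
      hodd h3 hHe hsq1 hsq2 ℓ₀ hℓ₀ hdK h2K Dt hopt hc β ι d₁ hy M₀ hdiv hndiv hM₀ Wd hWd hrd hSel hTam


/-- PROPOSED ITEM TEXT «K4PosDepthOneOnCut» (support/crux child of 25504, additive): K4Pos on its depth-one sub-cell (`M₀ = 1`), on the
multiplicative cut, Q2 as antecedent.  Binders = K4Pos VERBATIM + cut + `M₀ = 1`. -/
def K4PosDepthOneOnCut : Prop :=
  KolyvaginRelationAtTwo → ∀ (W : WeierstrassCurve ℚ) [W.IsElliptic] [W.IsGloballyMinimal] [NeZero (W.conductorNorm ℤ)], ¬ W.HasCM → W.analyticRank = 0 → (∀ n : ℕ, 0 < n → W.HasSurjectiveModNGaloisRep ((2 : ℤ) ^ n)) → Odd W.tamagawaProduct → 0 < W.Δ → (Nat.card (W.selmerGroup 2) = 4 ∧ ∃ c ∈ (W.kummerSelmerStructure ((2 : ℕ) : ℤ)).selmerGroup, Literature.NumberTheory.GaloisRepresentations.galoisCohomology.localization (W.torsionGaloisModule ((2 : ℕ) : ℤ)) (Sum.inl Rat.infinitePlace) 1 c ≠ 0) → ∀ (v : IsDedekindDomain.HeightOneSpectrum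 (NumberField.RingOfIntegers ℚ)), ((2 : ℕ) : NumberField.RingOfIntegers ℚ) ∉ v.asIdeal → ((W.conductorNorm ℤ : ℕ) : NumberField.RingOfIntegers ℚ) ∈ v.asIdeal → W.HasMultiplicativeReductionAt v → ∀ (K : Type) [Field K] [NumberField K], Literature.NumberTheory.EllipticCurves.IsImaginaryQuadratic K → Odd (NumberField.discr K) → NumberField.discr K ≠ -3 → Literature.NumberTheory.EllipticCurves.SatisfiesHeegnerHypothesis (W.conductorNorm ℤ) K → ¬ IsSquare ((NumberField.discr K : ℚ) * -|W.Δ|) → ¬ IsSquare ((NumberField.discr K : ℚ) * (-(2 * |W.Δ|))) → ∀ (ℓ₀ : ℕ), ℓ₀.Prime → NumberField.discr K = -(ℓ₀ : ℤ) → ((Ideal.span {(2 : ℤ)}).primesOver (NumberField.RingOfIntegers K)).ncard = 2 → ∀ (Dt : Literature.NumberTheory.EllipticCurves.ModularForms.ModularParametrizationData W (W.conductorNorm ℤ)), (∀ z ∈ Dt.L.lattice, ∃ w ∈ Literature.NumberTheory.EllipticCurves.ModularForms.periodLattice Dt.f, z = (Dt.c : ℂ) * w) → Odd Dt.c → ∀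 (β : ℤ) (ι : K →+* ℂ) (d₁ : Literature.NumberTheory.EllipticCurves.KolyvaginHeegnerData Dt β ι 1), ¬ IsOfFinAddOrder d₁.derivedPoint → ∀ (M₀ : ℕ), (∃ Q : (W.baseChange (Literature.NumberTheory.EllipticCurves.ringClassField K ι 1)).toAffine.Point, ((2 ^ M₀ : ℕ) : ℤ) • Q = d₁.derivedPoint) → (¬ ∃ Q : (W.baseChange (Literature.NumberTheory.EllipticCurves.ringClassField K ι 1)).toAffine.Point, ((2 ^ (M₀ + 1) : ℕ) : ℤ) • Q = d₁.derivedPoint) → M₀ = 1 → ∀ (Wd : WeierstrassCurve ℚ) [Wd.IsElliptic] [Wd.IsGloballyMinimal], (∃ C : WeierstrassCurve.VariableChange ℚ, C • W.quadraticTwist (NumberField.discr K : ℚ) = Wd) → Wd.analyticRank = 1 → Nat.card (Wd.selmerGroup 2) = 2 → padicValNat 2 Wd.tamagawaProduct = 0 → ∃ (n : ℕ) (d : Literature.NumberTheory.EllipticCurves.KolyvaginHeegnerData Dt β ι n), Squarefree n ∧ (∀ ℓ ∈ n.primeFactors, Literature.NumberTheory.EllipticCurves.Zhang2014.IsKolyvaginPrime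 (W.conductorNorm ℤ) W K 2 ℓ ∧ 2 ≤ Literature.NumberTheory.EllipticCurves.Zhang2014.kolyvaginIndex W 2 ℓ ∧ ∃ (v : IsDedekindDomain.HeightOneSpectrum (NumberField.RingOfIntegers ℚ)) (𝔓 : Ideal (Literature.NumberTheory.GaloisRepresentations.absIntegers (NumberField.RingOfIntegers ℚ) ℚ)) (h : Field.absoluteGaloisGroup ℚ), ((ℓ : ℕ) : NumberField.RingOfIntegers ℚ) ∈ v.asIdeal ∧ 𝔓 ∈ v.primesAbove ∧ IsArithFrobAt (NumberField.RingOfIntegers ℚ) h 𝔓 ∧ ∃ u : W.geomTorsion ((2 : ℕ) : ℤ), h • u ≠ u) ∧ ¬ ∃ Q : (W.baseChange (Literature.NumberTheory.EllipticCurves.ringClassField K ι n)).toAffine.Point, (2 : ℤ) • Q = d.derivedPoint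

/-- The BY-NAME closer of the proposed K₄⁺ item (eta-expansion of gk2-p5 g36's `kFourPos_conclusion_of_depth_one_of_hasMultiplicativeReductionAt`,
p771276).  BSD is NOT proved by this; K4Pos at depth ≥ 2 stays open. -/
theorem k4PosDepthOneOnCut_holds : K4PosDepthOneOnCut :=
  fun hQ2 W _ _ _ hcm hr0 hρ hT hpos hcell v h2v hNv hmult K _ _ hIQ hodd h3 hHe hsq1 hsq2 ℓ₀ hℓ₀ hdK h2K Dt hopt hc β ι d₁ hy M₀ hdiv hndiv
      hM₀ Wd _ _ hWd hrd hSel hTam ↦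
    GenusExact.PlusDescent.kFourPos_conclusion_of_depth_one_of_hasMultiplicativeReductionAt hQ2 W hcm hr0 hρ hT hpos hcell v h2v hNv hmult K
      hIQ hodd h3 hHe hsq1 hsq2 ℓ₀ hℓ₀ hdK h2K Dt hopt hc β ι d₁ hy M₀ hdiv hndiv hM₀ Wd hWd hrd hSel hTam

end Summit.BirchSwinnertonDyer.BirchSwinnertonDyer.Theorems.GenusSupplyNarrow.KFourCell.DepthOneItem

end
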